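import Mathlib.MeasureTheory.Constructions.HaarToSphere
import Mathlib.MeasureTheory.Measure.Lebesgue.VolumeOfBalls
import Mathlib.MeasureTheory.Integral.IntegralEqImproper
import Mathlib.MeasureTheory.Integral.IntervalIntegral.FundThmCalculus
import Mathlib.Analysis.InnerProductSpace.Calculus
import Literature.Geometry.Lorentzian.MassCapacityProofs
import Literature.Geometry.Lorentzian.EndVolume
import Literature.Geometry.Lorentzian.ModelData
import Literature.Geometry.Lorentzian.ChartCalculus
import HarnessLib

-- literature-prover provefact seat `Bray2001_capacity_eq_of_penrose_eq` (model case), 2026-08-15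
/-!
# The capacity of the Schwarzschild horizon is `2m` (Bray 2001, Thm. 9, case of equality)

Theorems only; a sibling of `MassCapacity.lean` (Bray, J. Differential Geom. 59 (2001), §6,
Def. 17: the capacity `ℰ(Σ, g) = inf_φ (1/2π) ∫ |∇φ|² dV` of a horizon, vendored as
`horizonCapacity`) and `MassCapacityProofs.lean`. Bray's Thm. 9 reads *`m ≥ ½ ℰ(Σ, g)`, with
equality if and only if `(M³, g)` is a Schwarzschild manifold outside the horizon `Σ`*; the tree
vendors the inequality and the direction "equality ⇒ Schwarzschild" as the named facts
`Bray2001_mass_ge_half_capacity` and `Bray2001_capacity_rigidity`. This file PROVES the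
remaining direction, the model computation behind Def. 17 and (86)–(87):

* `Schwarzschild.horizonCapacity_timeSymmetricData` — for the time-symmetric Schwarzschild data
  `(ℝ³ ∖ {0}, (1 + m/2r)⁴ δ)` of mass `m > 0` (`Schwarzschild.timeSymmetricData`,
  `ModelData.lean`; Bray's (12)), the capacity of the horizon `Σ = {r = m/2}` with outside
  `{r > m/2}` (`Schwarzschild.throatOutside`) in the asymptotically flat end of the slice
  (`Schwarzschild.sliceEnd R`, the tautological end of inner radius `R > 0`) is
  `horizonCapacity … = ENNReal.ofReal (2 * m)`; equivalently
  (`horizonCapacity_timeSymmetricData_toReal_div_two`) `ℰ/2 = m`, which is the conclusion of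
  the §13 fact `Bray2001_capacity_eq_of_penrose_eq` (`PenroseRigidity.lean`) on its rigidity
  model, and the non-vacuity check of the encoding of Def. 17 announced in the docstring of
  `horizonCapacity` ("for the Schwarzschild exterior of mass `m` it equals `2m`").

The value is attained by Bray's Green's function (86), `φ = (1 - m/2r)/(1 + m/2r)`
(`Schwarzschild.greenFn`, a member of `IsCapacityTestFn`: `isCapacityTestFn_greenFn`), whose
energy is `4πm` (`dirichletEnergy_greenFn_le`), and no test function does better
(`le_dirichletEnergy_of_isCapacityTestFn`). Everything is proved; no named fact is used or
introduced. The only new definitions are the three objects just named and the auxiliary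
`SchwarzschildCapacity.extendByZero` / `greenProfile`.

## Proof

Write `a = m/2`, `ψ = 1 + a/r`, so that `g = ψ⁴ δ`, `dV_g = ψ⁶ dz` and `|∇φ|²_g = ψ⁻⁴ ‖∇φ̃‖²`
for the extension by zero `φ̃` of `φ` to `ℝ³` (`gradNorm_conformalData`,
`sqrt_det_hCoeff_conformalData`; the chart formula for the Riemannian measure in the chart of an
end, `AFEnd.setLIntegral_far` of `EndVolume.lean`, and the identification of manifold
derivatives on open subsets of `ℝ³` with Fréchet derivatives, `OpensChart.mfderiv_eq` of
`ChartCalculus.lean`). Hence `∫ |∇φ|²_g dV_g ≥ ∫_{r > a} ψ² ‖∇φ̃‖² dz`, with equality up to the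
region inside the horizon where a test function vanishes.

* *Lower bound* (Part I–II). In polar coordinates `z = rω` (Mathlib's
  `measurePreserving_homeomorphUnitSphereProd`: `dz = dσ(ω) r² dr`, `σ(S²) = 3|B³| = 4π`),
  `ψ² ‖∇φ̃‖² r² ≥ (r + a)² (∂_r φ̃)²`, and along each ray `f(r) = φ̃(rω)` satisfies `f(a) = 0`,
  `f → 1`, so by `f' ≤ (r+a)² f'²/(4a) + a/(r+a)²` (AM–GM) and the fundamental theorem of
  calculus on `[s, R] ⊆ (a, ∞)`, `f(R) - f(s) ≤ I/(4a) + a/(s+a)`, `I = ∫_a^∞ (r+a)² f'² dr`;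
  letting `s ↓ a`, `R → ∞` gives `1 ≤ I/(4a) + ½`, i.e. `I ≥ 2a`
  (`ofReal_two_mul_le_radialEnergy`). Integrating over `S²`: `∫ ψ² ‖∇φ̃‖² ≥ 8πa = 4πm`
  (`le_lintegral_shell_conformalGradSq`), so `(1/2π) ∫ |∇φ|² dV ≥ 2m`.
* *Upper bound* (Part V–VI). For `φ̃ = (r - a)/(r + a)` one has `‖∇φ̃‖ ≤ 2a/(r + a)²`
  (chain rule and `‖∇r‖ ≤ 1`), so `ψ² ‖∇φ̃‖² ≤ 4a²/(r²(r+a)²)`, whose integral over `{r > a}`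
  is `4π ∫_a^∞ 4a²/(r+a)² dr = 4π · 2a = 8πa` (`lintegral_shell_profile_le`,
  `lintegral_profileEnergy`); the horizon sphere itself is Lebesgue-null and inside it the
  integrand vanishes. Hence `ℰ ≤ (1/2π) · 4πm = 2m`.

## Mathlib

Polar coordinates and Haar measure on spheres: `MeasureTheory.Measure.toSphere`,
`Measure.volumeIoiPow`, `measurePreserving_homeomorphUnitSphereProd`, `Measure.toSphere_apply_univ`,
`EuclideanSpace.volume_ball_fin_three`, `Measure.addHaar_sphere`; integration:
`lintegral_prod`, `lintegral_prod_le`, `lintegral_subtype_comap`, `MeasurePreserving.lintegral_comp_emb`,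
`lintegral_withDensity_eq_lintegral_mul_non_measurable`, `intervalIntegral.integral_eq_sub_of_hasDerivAt`,
`intervalIntegral.integral_mono_on`, `integral_Ioi_of_hasDerivAt_of_tendsto`,
`integrableOn_Ioi_deriv_of_nonneg`, `measurable_fderiv`; calculus: `contDiffAt_norm`,
`DifferentiableAt.norm`, `norm_fderiv_le_of_lipschitz`, `lipschitzWith_one_norm`,
`HasDerivAt.comp_hasFDerivAt`, `HasFDerivAt.comp_hasDerivAt`, `innerSL_apply_norm`,
`EuclideanSpace.orthonormal_single`. From the Lorentz prelude: `horizonCapacity`,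
`IsCapacityTestFn`, `dirichletEnergy`, `gradNorm`, `TendstoAtEnd`, `endValue`,
`PseudoRiemannianMetric.sharp`/`innerDual`/`val_sharp_apply`, `gradNorm_eq_zero_of_eventuallyEq_const`
(`MassCapacityProofs.lean`), `AFEnd.setLIntegral_far`, `AFEnd.riemannianMeasure_image_dataChartExt`
(`EndVolume.lean`), `AFEnd.hCoeff_of_lt`, `pullbackBilin_apply`, `inclusionAFEnd`, `OpensChart.*`
(`ModelData.lean`, `ChartCalculus.lean`; the identity differential of the inverse chart of an
inclusion end is re-derived inline as in `ModelDataProofs.lean`, which is not imported to keep the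
import closure free of the Cauchy-problem files), `Schwarzschild.timeSymmetricData`,
`conformalData`, `conformalFactor`, `puncturedSlice`.

## References

* H. L. Bray, *Proof of the Riemannian Penrose inequality using the positive mass theorem*,
  J. Differential Geom. 59 (2001) 177–267 (arXiv:math/9911173; same numbering): §1 (12) (the
  Schwarzschild metric `(1 + m/2r)⁴ δ` on `ℝ³ ∖ {0}`), §6 Def. 17 (85), (86)–(87) (the Green's
  function and `φ = 1 - ℰ/(2|x|) + O(|x|⁻²)`), Thm. 9 (case of equality); §13 (proof of the
  case of equality: `ℰ(Σ⁺(0), g₀) = 2 m(0)`).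
* H. Federer, *Geometric Measure Theory*, Springer 1969, §3.2.46 (Riemannian measure in a chart).
-/

noncomputable section

open Set Filter MeasureTheory Metric Topology
open scoped ENNReal Topology Real

namespace Literature.Geometry.Lorentzian

namespace SchwarzschildCapacity

/-! ### Part I. The radial Dirichlet integral -/

section Radial

/-- AM–GM in the form used along each ray: `u ≤ (r + a)² u² / (4a) + a / (r + a)²`. [folklore] -/
theorem le_weight_sq_add (a r u : ℝ) (ha : 0 < a) (hr : 0 < r + a) :
    u ≤ (r + a) ^ 2 * u ^ 2 / (4 * a) + a / (r + a) ^ 2 := by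
  rw [div_add_div _ _ (by positivity) (by positivity), le_div_iff₀ (by positivity)]
  nlinarith [sq_nonneg ((r + a) ^ 2 * u - 2 * a), sq_nonneg (r + a)]

/-- `∫_s^R a/(r+a)² dr = a (1/(s+a) - 1/(R+a))` for `-a < s ≤ R`. [folklore] -/
theorem integral_const_div_add_sq {a s R : ℝ} (hs : 0 < s + a) (hsR : s ≤ R) :
    ∫ r in s..R, a / (r + a) ^ 2 = a * (1 / (s + a) - 1 / (R + a)) := by
  have hderiv : ∀ r ∈ uIcc s R, HasDerivAt (fun r ↦ -a * (r + a)⁻¹) (a / (r + a) ^ 2) r := by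
    intro r hr
    rw [uIcc_of_le hsR] at hr
    have hr' : (r + a) ≠ 0 := by linarith [hr.1]
    have h1 : HasDerivAt (fun r ↦ r + a) 1 r := (hasDerivAt_id r).add_const a
    have h2 : HasDerivAt (fun r ↦ -a * (r + a)⁻¹) (-a * (-1 / (r + a) ^ 2)) r :=
      (h1.inv hr').const_mul (-a)
    exact h2.congr_deriv (by ring)
  have hcont : ContinuousOn (fun r ↦ a / (r + a) ^ 2) (uIcc s R) := by
    rw [uIcc_of_le hsR]
    refine continuousOn_const.div (by fun_prop) fun r hr ↦ ?_
    have : 0 < r + a := by linarith [hr.1]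
    positivity
  rw [intervalIntegral.integral_eq_sub_of_hasDerivAt hderiv (hcont.intervalIntegrable)]
  have h1 : (R + a) ≠ 0 := by linarith
  have h2 : (s + a) ≠ 0 := by linarith
  field_simp
  ring

/-- The key estimate along a ray: for `a < s ≤ R`,
`f R - f s ≤ I/(4a) + a (1/(s+a) - 1/(R+a))`, `I = ∫_a^∞ (r+a)² f'(r)² dr`. [folklore] -/
theorem sub_le_radialEnergy {a : ℝ} (ha : 0 < a) {f f' : ℝ → ℝ}
    (hd : ∀ r ∈ Ioi a, HasDerivAt f (f' r) r) (hc : ContinuousOn f' (Ioi a))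
    (hI : ∫⁻ r in Ioi a, ENNReal.ofReal ((r + a) ^ 2 * f' r ^ 2) ≠ ∞)
    {s R : ℝ} (hs : a < s) (hsR : s ≤ R) :
    f R - f s ≤ (∫⁻ r in Ioi a, ENNReal.ofReal ((r + a) ^ 2 * f' r ^ 2)).toReal / (4 * a)
      + a * (1 / (s + a) - 1 / (R + a)) := by
  set w : ℝ → ℝ := fun r ↦ (r + a) ^ 2 * f' r ^ 2 with hw
  have hsub : Icc s R ⊆ Ioi a := fun r hr ↦ lt_of_lt_of_le hs hr.1
  have hsub' : uIcc s R ⊆ Ioi a := by rw [uIcc_of_le hsR]; exact hsub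
  have hwc : ContinuousOn w (Ioi a) := by
    refine ContinuousOn.mul (by fun_prop) (hc.pow 2)
  -- FTC
  have hftc : ∫ r in s..R, f' r = f R - f s :=
    intervalIntegral.integral_eq_sub_of_hasDerivAt (fun r hr ↦ hd r (hsub' hr))
      ((hc.mono hsub').intervalIntegrable)
  -- comparison of the integrands
  have hmono : ∫ r in s..R, f' r ≤ ∫ r in s..R, (w r / (4 * a) + a / (r + a) ^ 2) := by
    refine intervalIntegral.integral_mono_on hsR ((hc.mono hsub').intervalIntegrable) ?_ ?_
    · refine ((hwc.mono hsub').div_const _).intervalIntegrable.add ?_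
      refine (continuousOn_const.div (by fun_prop) fun r hr ↦ ?_).intervalIntegrable
      have : 0 < r + a := by linarith [(hsub' hr).out]
      positivity
    · intro r hr
      have hra : 0 < r + a := by linarith [hr.1]
      simpa [hw] using le_weight_sq_add a r (f' r) ha hra
  have hsplit : ∫ r in s..R, (w r / (4 * a) + a / (r + a) ^ 2) =
      (∫ r in s..R, w r) / (4 * a) + a * (1 / (s + a) - 1 / (R + a)) := by
    rw [intervalIntegral.integral_add ((hwc.mono hsub').div_const _).intervalIntegrable,
      intervalIntegral.integral_div, integral_const_div_add_sq (by linarith) hsR]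
    refine (continuousOn_const.div (by fun_prop) fun r hr ↦ ?_).intervalIntegrable
    have : 0 < r + a := by linarith [(hsub' hr).out]
    positivity
  -- the finite-interval energy is bounded by the total energy
  have hwI : ∫ r in s..R, w r ≤ (∫⁻ r in Ioi a, ENNReal.ofReal (w r)).toReal := by
    rw [intervalIntegral.integral_of_le hsR,
      integral_eq_lintegral_of_nonneg_ae (Eventually.of_forall fun r ↦ by positivity)
        ((hwc.mono (Ioc_subset_Icc_self.trans hsub)).aestronglyMeasurable measurableSet_Ioc)]
    exact ENNReal.toReal_mono hI (lintegral_mono_set (Ioc_subset_Icc_self.trans hsub))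
  have h4a : 0 < 4 * a := by positivity
  calc f R - f s = ∫ r in s..R, f' r := hftc.symm
    _ ≤ (∫ r in s..R, w r) / (4 * a) + a * (1 / (s + a) - 1 / (R + a)) := hmono.trans_eq hsplit
    _ ≤ _ := by gcongr

/-- **The radial Dirichlet integral.** If `f` is `C¹` on `(a, ∞)` (`a > 0`), tends to `0` at
`a⁺` and to `1` at `+∞`, then `∫_a^∞ (r + a)² f'(r)² dr ≥ 2a` (as a lower Lebesgue integral).
Equality holds for `f(r) = (r - a)/(r + a)`, the Schwarzschild Green's function along a ray.
[folklore] -/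
theorem ofReal_two_mul_le_radialEnergy {a : ℝ} (ha : 0 < a) {f f' : ℝ → ℝ}
    (hd : ∀ r ∈ Ioi a, HasDerivAt f (f' r) r) (hc : ContinuousOn f' (Ioi a))
    (h0 : Tendsto f (𝓝[>] a) (𝓝 0)) (h1 : Tendsto f atTop (𝓝 1)) :
    ENNReal.ofReal (2 * a) ≤ ∫⁻ r in Ioi a, ENNReal.ofReal ((r + a) ^ 2 * f' r ^ 2) := by
  set I := ∫⁻ r in Ioi a, ENNReal.ofReal ((r + a) ^ 2 * f' r ^ 2) with hI
  by_cases htop : I = ∞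
  · rw [htop]; exact le_top
  suffices h : (1 : ℝ) ≤ I.toReal / (4 * a) + 1 / 2 by
    rw [← ENNReal.ofReal_toReal htop]
    apply ENNReal.ofReal_le_ofReal
    have h4a : 0 < 4 * a := by positivity
    have : 1 / 2 ≤ I.toReal / (4 * a) := by linarith
    rw [le_div_iff₀ h4a] at this
    linarith
  by_contra hlt
  replace hlt : I.toReal / (4 * a) + 1 / 2 < 1 := not_le.mp hlt
  set δ := 1 - (I.toReal / (4 * a) + 1 / 2) with hδ
  have hδpos : 0 < δ := by linarith
  obtain ⟨s, hfs, has⟩ : ∃ s, f s < δ / 2 ∧ a < s :=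
    ((h0.eventually (gt_mem_nhds (by linarith : (0 : ℝ) < δ / 2))).and
      self_mem_nhdsWithin).exists
  obtain ⟨R, hfR, hsR⟩ : ∃ R, 1 - δ / 2 < f R ∧ s ≤ R :=
    ((h1.eventually (lt_mem_nhds (by linarith : (1 : ℝ) - δ / 2 < 1))).and
      (eventually_ge_atTop s)).exists
  have key := sub_le_radialEnergy ha hd hc htop has hsR
  have hbound : a * (1 / (s + a) - 1 / (R + a)) ≤ 1 / 2 := by
    have hRa : 0 < R + a := by linarith
    have h1' : 1 / (s + a) ≤ 1 / (2 * a) :=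
      one_div_le_one_div_of_le (by positivity) (by linarith)
    have h2' : 0 ≤ 1 / (R + a) := by positivity
    calc a * (1 / (s + a) - 1 / (R + a)) ≤ a * (1 / (2 * a)) := by
          gcongr; linarith
      _ = 1 / 2 := by field_simp
  linarith

/-- The energy of the Schwarzschild profile along a ray:
`∫_a^∞ 4a²/(r+a)² dr = 2a` (`f = (r-a)/(r+a)`, `(r+a)² f'² = 4a²/(r+a)²`). [folklore] -/
theorem lintegral_profileEnergy {a : ℝ} (ha : 0 < a) :
    ∫⁻ r in Ioi a, ENNReal.ofReal (4 * a ^ 2 / (r + a) ^ 2) = ENNReal.ofReal (2 * a) := by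
  have hderiv : ∀ r ∈ Ici a, HasDerivAt (fun r ↦ -(4 * a ^ 2) * (r + a)⁻¹)
      (4 * a ^ 2 / (r + a) ^ 2) r := by
    intro r hr
    have hr' : (r + a) ≠ 0 := by linarith [hr.out]
    have h1 : HasDerivAt (fun r ↦ r + a) 1 r := (hasDerivAt_id r).add_const a
    have h2 : HasDerivAt (fun r ↦ -(4 * a ^ 2) * (r + a)⁻¹) (-(4 * a ^ 2) * (-1 / (r + a) ^ 2)) r :=
      (h1.inv hr').const_mul (-(4 * a ^ 2))
    exact h2.congr_deriv (by ring)
  have hcont : ContinuousWithinAt (fun r ↦ -(4 * a ^ 2) * (r + a)⁻¹) (Ici a) a :=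
    (hderiv a Set.self_mem_Ici).continuousAt.continuousWithinAt
  have hlim : Tendsto (fun r : ℝ ↦ -(4 * a ^ 2) * (r + a)⁻¹) atTop (𝓝 0) := by
    have : Tendsto (fun r : ℝ ↦ (r + a)⁻¹) atTop (𝓝 0) :=
      tendsto_inv_atTop_zero.comp (tendsto_atTop_add_const_right _ _ tendsto_id)
    simpa using this.const_mul (-(4 * a ^ 2))
  have hnn : ∀ r ∈ Ioi a, 0 ≤ 4 * a ^ 2 / (r + a) ^ 2 := fun r hr ↦ by
    have : 0 < r + a := by linarith [hr.out]
    positivity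
  have hint : IntegrableOn (fun r ↦ 4 * a ^ 2 / (r + a) ^ 2) (Ioi a) :=
    integrableOn_Ioi_deriv_of_nonneg hcont (fun r hr ↦ hderiv r (mem_Ici.2 (le_of_lt (mem_Ioi.1 hr)))) hnn hlim
  have hval : ∫ r in Ioi a, 4 * a ^ 2 / (r + a) ^ 2 = 2 * a := by
    rw [integral_Ioi_of_hasDerivAt_of_tendsto hcont
      (fun r hr ↦ hderiv r (mem_Ici.2 (le_of_lt (mem_Ioi.1 hr)))) hint hlim]
    field_simp
    ring
  rw [← hval, ofReal_integral_eq_lintegral_ofReal hint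
    ((ae_restrict_iff' measurableSet_Ioi).2 (Eventually.of_forall hnn))]

end Radial

/-! ### Part II. Polar coordinates in `ℝ³`: the conformal Dirichlet integral over the shell -/

section Polar

open Bornology

/-- **Polar coordinates for the lower Lebesgue integral on `ℝ³`**: for every `G : ℝ³ → [0, ∞]`,
`∫ G dx = ∫ G(r ω) d(σ ⊗ r² dr)(ω, r)` over `S² × (0, ∞)`, `σ = volume.toSphere` (Mathlib's
`measurePreserving_homeomorphUnitSphereProd`; the origin is a null set; no measurability of `G`
is needed, the polar map being a measurable embedding). [folklore] -/
theorem lintegral_eq_lintegral_polar (G : E3 → ℝ≥0∞) :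
    ∫⁻ x, G x = ∫⁻ z : sphere (0 : E3) 1 × Ioi (0 : ℝ), G ((z.2 : ℝ) • (z.1 : E3))
      ∂((volume : Measure E3).toSphere.prod (Measure.volumeIoiPow 2)) := by
  have hmp := (volume : Measure E3).measurePreserving_homeomorphUnitSphereProd
  have hdim : Module.finrank ℝ E3 - 1 = 2 := by
    rw [finrank_euclideanSpace_fin]
  rw [hdim] at hmp
  set F : sphere (0 : E3) 1 × Ioi (0 : ℝ) → ℝ≥0∞ := fun z ↦ G ((z.2 : ℝ) • (z.1 : E3)) with hF
  calc ∫⁻ x, G x = ∫⁻ x in ({0}ᶜ : Set E3), G x := by rw [restrict_compl_singleton]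
    _ = ∫⁻ y : ({0}ᶜ : Set E3), G y ∂((volume : Measure E3).comap Subtype.val) :=
        (lintegral_subtype_comap (measurableSet_singleton _).compl G).symm
    _ = ∫⁻ y : ({0}ᶜ : Set E3), F (homeomorphUnitSphereProd E3 y)
          ∂((volume : Measure E3).comap Subtype.val) := by
        refine lintegral_congr fun y ↦ ?_
        have h := homeomorphUnitSphereProd_symm_apply_coe E3 (homeomorphUnitSphereProd E3 y)
        rw [Homeomorph.symm_apply_apply] at h
        rw [hF]
        simp only [← h]
    _ = ∫⁻ z, F z ∂((volume : Measure E3).toSphere.prod (Measure.volumeIoiPow 2)) :=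
        hmp.lintegral_comp_emb (Homeomorph.measurableEmbedding (homeomorphUnitSphereProd E3)) F

/-- The radial factor of the polar decomposition: `∫ F d(r² dr) = ∫_0^∞ r² F(r) dr` on `(0, ∞)`
(no measurability of `F` needed). [folklore] -/
theorem lintegral_volumeIoiPow_two (F : Ioi (0 : ℝ) → ℝ≥0∞) :
    ∫⁻ r, F r ∂(Measure.volumeIoiPow 2) =
      ∫⁻ r in Ioi (0 : ℝ), ENNReal.ofReal (r ^ 2) * Function.extend Subtype.val F 0 r := by
  have hmeas : Measurable fun r : Ioi (0 : ℝ) ↦ ENNReal.ofReal ((r : ℝ) ^ 2) :=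
    ENNReal.measurable_ofReal.comp (measurable_subtype_coe.pow_const 2)
  rw [Measure.volumeIoiPow, lintegral_withDensity_eq_lintegral_mul_non_measurable _ hmeas
    (Eventually.of_forall fun _ ↦ ENNReal.ofReal_lt_top) F,
    ← lintegral_subtype_comap measurableSet_Ioi]
  refine lintegral_congr fun r ↦ ?_
  simp only [Pi.mul_apply, Subtype.val_injective.extend_apply]

/-- The radial factor for a function of `r • ω`: `∫ G(r ω) d(r² dr) = ∫_0^∞ r² G(r ω) dr`.
[folklore] -/
theorem lintegral_volumeIoiPow_two_smul (G : E3 → ℝ≥0∞) (ω : E3) :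
    ∫⁻ r : Ioi (0 : ℝ), G ((r : ℝ) • ω) ∂(Measure.volumeIoiPow 2) =
      ∫⁻ r in Ioi (0 : ℝ), ENNReal.ofReal (r ^ 2) * G (r • ω) := by
  rw [lintegral_volumeIoiPow_two]
  refine setLIntegral_congr_fun measurableSet_Ioi fun r hr ↦ ?_
  have : Function.extend Subtype.val (fun r : Ioi (0 : ℝ) ↦ G ((r : ℝ) • ω)) 0 r =
      G (r • ω) := by
    simpa using Subtype.val_injective.extend_apply (fun r : Ioi (0 : ℝ) ↦ G ((r : ℝ) • ω)) 0
      ⟨r, hr⟩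
  rw [this]

/-- The total mass of `volume.toSphere` on `S² ⊆ ℝ³` is `4π` (`3 · |B³| = 3 · 4π/3`). [folklore] -/
theorem toSphere_univ_E3 : (volume : Measure E3).toSphere univ = ENNReal.ofReal (4 * π) := by
  rw [Measure.toSphere_apply_univ, finrank_euclideanSpace_fin, EuclideanSpace.volume_ball_fin_three,
    ENNReal.ofReal_one, one_pow, one_mul, Nat.cast_ofNat, ← ENNReal.ofReal_ofNat 3,
    ← ENNReal.ofReal_mul (by norm_num)]
  congr 1
  ring

/-- The ray `r ↦ r ω` (`‖ω‖ = 1`) tends to infinity in `ℝ³`. [folklore] -/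
theorem tendsto_smul_ray_cobounded {ω : E3} (hω : ‖ω‖ = 1) :
    Tendsto (fun r : ℝ ↦ r • ω) atTop (cobounded E3) := by
  rw [← comap_norm_atTop, tendsto_comap_iff]
  refine tendsto_id.congr' ?_
  filter_upwards [eventually_ge_atTop 0] with r hr
  simp [norm_smul, hω, abs_of_nonneg hr]

/-- **The conformal Dirichlet integral over the shell is at least `8πa`.** If `φ : ℝ³ → ℝ` is
continuous at the sphere `‖x‖ = a` (`a > 0`), `C¹` on the open shell `{a < ‖x‖}`, vanishes on
the sphere and tends to `1` at infinity, then
`∫_{a < ‖x‖} (1 + a/‖x‖)² ‖∇φ‖² dx ≥ 8πa`: in polar coordinates the integrand dominates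
`(r + a)² (∂_r φ)²` along every ray, to which Part I applies, and `|S²| = 4π`. With `a = m/2`
this is `∫ ψ² |∇φ|² ≥ 4πm` for the Schwarzschild factor `ψ = 1 + m/2r`. [folklore] -/
theorem le_lintegral_shell_conformalGradSq {a : ℝ} (ha : 0 < a) {φ : E3 → ℝ}
    (hcont : ∀ x : E3, ‖x‖ = a → ContinuousAt φ x)
    (hdiff : ContDiffOn ℝ 1 φ {x : E3 | a < ‖x‖})
    (h0 : ∀ x : E3, ‖x‖ = a → φ x = 0)
    (h1 : Tendsto φ (cobounded E3) (𝓝 1)) :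
    ENNReal.ofReal (8 * π * a) ≤
      ∫⁻ x in {x : E3 | a < ‖x‖}, ENNReal.ofReal ((1 + a / ‖x‖) ^ 2 * ‖fderiv ℝ φ x‖ ^ 2) := by
  have hopen : IsOpen {x : E3 | a < ‖x‖} := isOpen_lt continuous_const continuous_norm
  set G : E3 → ℝ≥0∞ := {x : E3 | a < ‖x‖}.indicator fun x ↦
    ENNReal.ofReal ((1 + a / ‖x‖) ^ 2 * ‖fderiv ℝ φ x‖ ^ 2) with hG
  have hGm : Measurable G := by
    refine Measurable.indicator (ENNReal.measurable_ofReal.comp ?_) hopen.measurableSet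
    exact ((measurable_const.add (measurable_const.div measurable_norm)).pow_const 2).mul
      ((measurable_fderiv ℝ φ).norm.pow_const 2)
  rw [← lintegral_indicator hopen.measurableSet, ← hG, lintegral_eq_lintegral_polar G,
    lintegral_prod (fun z : sphere (0 : E3) 1 × Ioi (0 : ℝ) ↦ G ((z.2 : ℝ) • (z.1 : E3)))
      (Measurable.aemeasurable (hGm.comp (by fun_prop)))]
  -- the bound along each ray
  have hray : ∀ ω : sphere (0 : E3) 1, ENNReal.ofReal (2 * a) ≤
      ∫⁻ r : Ioi (0 : ℝ), G ((r : ℝ) • (ω : E3)) ∂(Measure.volumeIoiPow 2) := by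
    intro ω
    have hω : ‖(ω : E3)‖ = 1 := by simp
    have hnorm : ∀ r : ℝ, 0 ≤ r → ‖r • (ω : E3)‖ = r := fun r hr ↦ by
      rw [norm_smul, hω, mul_one, Real.norm_of_nonneg hr]
    have hmem : ∀ r ∈ Ioi a, r • (ω : E3) ∈ {x : E3 | a < ‖x‖} := fun r hr ↦ by
      show a < ‖r • (ω : E3)‖
      rw [hnorm r (ha.trans hr).le]
      exact hr
    have hray_cont : Continuous fun r : ℝ ↦ r • (ω : E3) := by fun_prop
    set f : ℝ → ℝ := fun r ↦ φ (r • (ω : E3)) with hf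
    set f' : ℝ → ℝ := fun r ↦ fderiv ℝ φ (r • (ω : E3)) (ω : E3) with hf'
    have hd : ∀ r ∈ Ioi a, HasDerivAt f (f' r) r := by
      intro r hr
      have hφ : HasFDerivAt φ (fderiv ℝ φ (r • (ω : E3))) (r • (ω : E3)) :=
        ((hdiff.differentiableOn one_ne_zero).differentiableAt (hopen.mem_nhds (hmem r hr))).hasFDerivAt
      have hl : HasDerivAt (fun r : ℝ ↦ r • (ω : E3)) ((1 : ℝ) • (ω : E3)) r :=
        (hasDerivAt_id r).smul_const _
      have h := hφ.comp_hasDerivAt r hl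
      rw [one_smul] at h
      exact h
    have hc : ContinuousOn f' (Ioi a) :=
      ((hdiff.continuousOn_fderiv_of_isOpen hopen le_rfl).comp hray_cont.continuousOn hmem).clm_apply
        continuousOn_const
    have hf0 : Tendsto f (𝓝[>] a) (𝓝 0) := by
      have hfa : f a = 0 := h0 _ (hnorm a ha.le)
      have hca : ContinuousAt f a :=
        ContinuousAt.comp (f := fun r : ℝ ↦ r • (ω : E3)) (x := a) (hcont _ (hnorm a ha.le))
          hray_cont.continuousAt
      rw [← hfa]
      exact hca.tendsto.mono_left nhdsWithin_le_nhds
    have hf1 : Tendsto f atTop (𝓝 1) := h1.comp (tendsto_smul_ray_cobounded hω)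
    refine (ofReal_two_mul_le_radialEnergy ha hd hc hf0 hf1).trans ?_
    rw [lintegral_volumeIoiPow_two_smul]
    refine (setLIntegral_mono' measurableSet_Ioi fun r hr ↦ ?_).trans
      (lintegral_mono_set (Ioi_subset_Ioi ha.le))
    have hr0 : 0 < r := ha.trans hr
    rw [hG, indicator_of_mem (hmem r hr), ← ENNReal.ofReal_mul (sq_nonneg r), hnorm r hr0.le]
    apply ENNReal.ofReal_le_ofReal
    have hle : |f' r| ≤ ‖fderiv ℝ φ (r • (ω : E3))‖ := by
      simpa [hf', hω] using (fderiv ℝ φ (r • (ω : E3))).le_opNorm (ω : E3)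
    have hsq : f' r ^ 2 ≤ ‖fderiv ℝ φ (r • (ω : E3))‖ ^ 2 := by
      rw [← sq_abs (f' r)]
      exact pow_le_pow_left₀ (abs_nonneg _) hle 2
    have hra : (r + a) ^ 2 = r ^ 2 * (1 + a / r) ^ 2 := by
      field_simp
    rw [hra, mul_assoc]
    gcongr
  -- integrate over the sphere
  calc ENNReal.ofReal (8 * π * a)
      = ∫⁻ _ : sphere (0 : E3) 1, ENNReal.ofReal (2 * a) ∂(volume : Measure E3).toSphere := by
        rw [lintegral_const, toSphere_univ_E3, ← ENNReal.ofReal_mul (by positivity)]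
        congr 1
        ring
    _ ≤ _ := lintegral_mono hray

/-- **The radial model integral**: `∫_{a < ‖x‖} 4a² / (‖x‖² (‖x‖ + a)²) dx = 8πa`-bounded —
precisely, the shell integral of `x ↦ 4a²/(‖x‖²(‖x‖+a)²)` is at most `8πa` (it equals `8πa`;
only the inequality is used). This is the conformal Dirichlet integral `∫ ψ² |∇φ|²` of the
Schwarzschild Green's function `φ = (r - a)/(r + a)` (`|∇φ| = 2a/(r+a)²`). [folklore] -/
theorem lintegral_shell_profile_le {a : ℝ} (ha : 0 < a) :
    ∫⁻ x in {x : E3 | a < ‖x‖}, ENNReal.ofReal (4 * a ^ 2 / (‖x‖ ^ 2 * (‖x‖ + a) ^ 2)) ≤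
      ENNReal.ofReal (8 * π * a) := by
  have hopen : IsOpen {x : E3 | a < ‖x‖} := isOpen_lt continuous_const continuous_norm
  set G : E3 → ℝ≥0∞ := {x : E3 | a < ‖x‖}.indicator fun x ↦
    ENNReal.ofReal (4 * a ^ 2 / (‖x‖ ^ 2 * (‖x‖ + a) ^ 2)) with hG
  rw [← lintegral_indicator hopen.measurableSet, ← hG, lintegral_eq_lintegral_polar G]
  refine (lintegral_prod_le _).trans ?_
  have hray : ∀ ω : sphere (0 : E3) 1,
      ∫⁻ r : Ioi (0 : ℝ), G ((r : ℝ) • (ω : E3)) ∂(Measure.volumeIoiPow 2) =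
        ENNReal.ofReal (2 * a) := by
    intro ω
    have hω : ‖(ω : E3)‖ = 1 := by simp
    have hnorm : ∀ r : ℝ, 0 ≤ r → ‖r • (ω : E3)‖ = r := fun r hr ↦ by
      rw [norm_smul, hω, mul_one, Real.norm_of_nonneg hr]
    rw [lintegral_volumeIoiPow_two_smul, ← lintegral_profileEnergy ha]
    -- both integrands vanish on `(0, a]` resp. agree on `(a, ∞)`
    have hsplit : ∫⁻ r in Ioi (0 : ℝ), ENNReal.ofReal (r ^ 2) * G (r • (ω : E3)) =
        ∫⁻ r in Ioi a, ENNReal.ofReal (r ^ 2) * G (r • (ω : E3)) := by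
      rw [← Ioc_union_Ioi_eq_Ioi ha.le, lintegral_union measurableSet_Ioi
        (Set.disjoint_left.2 fun r h1 h2 ↦ (not_lt.2 h1.2) h2)]
      have hzero : ∫⁻ r in Ioc 0 a, ENNReal.ofReal (r ^ 2) * G (r • (ω : E3)) = 0 := by
        rw [setLIntegral_congr_fun measurableSet_Ioc (g := fun _ ↦ 0) ?_, lintegral_zero]
        intro r hr
        have : r • (ω : E3) ∉ {x : E3 | a < ‖x‖} := by
          show ¬ a < ‖r • (ω : E3)‖
          rw [hnorm r hr.1.le]
          exact not_lt.2 hr.2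
        show ENNReal.ofReal (r ^ 2) * G (r • (ω : E3)) = 0
        rw [hG, indicator_of_notMem this, mul_zero]
      rw [hzero, zero_add]
    rw [hsplit]
    refine setLIntegral_congr_fun measurableSet_Ioi fun r hr ↦ ?_
    have hr0 : 0 < r := ha.trans hr
    have hmem : r • (ω : E3) ∈ {x : E3 | a < ‖x‖} := by
      show a < ‖r • (ω : E3)‖
      rw [hnorm r hr0.le]
      exact hr
    rw [hG, indicator_of_mem hmem, hnorm r hr0.le, ← ENNReal.ofReal_mul (sq_nonneg r)]
    congr 1
    field_simp
  calc ∫⁻ ω : sphere (0 : E3) 1, ∫⁻ r : Ioi (0 : ℝ), G ((r : ℝ) • (ω : E3))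
        ∂(Measure.volumeIoiPow 2) ∂(volume : Measure E3).toSphere
      = ∫⁻ _ : sphere (0 : E3) 1, ENNReal.ofReal (2 * a) ∂(volume : Measure E3).toSphere :=
        lintegral_congr hray
    _ = ENNReal.ofReal (8 * π * a) := by
        rw [lintegral_const, toSphere_univ_E3, ← ENNReal.ofReal_mul (by positivity)]
        congr 1
        ring
    _ ≤ _ := le_rfl

end Polar

/-! ### Part III. Functions on open subsets of `ℝ³`, read through their extension by zero -/

section OpensTransfer

open Bornology Manifold TopologicalSpace

variable {V : Opens E3}

/-- The **extension by zero** `φ̃ : ℝ³ → ℝ` of a function `φ` on an open subset `V ⊆ ℝ³`.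
[folklore] -/
def extendByZero (φ : V → ℝ) : E3 → ℝ :=
  Function.extend Subtype.val φ 0

/-- `φ̃` agrees with `φ` on `V`. [folklore] -/
@[simp]
theorem extendByZero_val (φ : V → ℝ) (y : V) : extendByZero φ y = φ y :=
  Subtype.val_injective.extend_apply _ _ _

/-- `φ̃` vanishes off `V`. [folklore] -/
theorem extendByZero_of_notMem (φ : V → ℝ) {z : E3} (hz : z ∉ (V : Set E3)) :
    extendByZero φ z = 0 := by
  rw [extendByZero, Function.extend_apply' _ _ _ fun ⟨y, hy⟩ ↦ hz (hy ▸ y.2)]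
  rfl

/-- `φ̃` at a point of `V`. [folklore] -/
theorem extendByZero_of_mem (φ : V → ℝ) {z : E3} (hz : z ∈ (V : Set E3)) :
    extendByZero φ z = φ ⟨z, hz⟩ :=
  extendByZero_val φ ⟨z, hz⟩

/-- A continuous function on `V` has an extension by zero continuous at every point of `V`
(the inclusion is an open embedding). [folklore] -/
theorem continuousAt_extendByZero {φ : V → ℝ} (hφ : Continuous φ) (y : V) :
    ContinuousAt (extendByZero φ) (y : E3) :=
  (OpensChart.continuousAt_iff y φ (extendByZero φ) fun y ↦ (extendByZero_val φ y).symm).1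
    hφ.continuousAt

/-- Smoothness on an open `W ⊆ V` in the manifold sense is smoothness of the extension by zero on
`W ⊆ ℝ³`. [folklore] -/
theorem contDiffOn_extendByZero {φ : V → ℝ} {n : WithTop ℕ∞} {W : Opens V}
    (hφ : ContMDiffOn 𝓘(ℝ, E3) 𝓘(ℝ, ℝ) n φ (W : Set V)) :
    ContDiffOn ℝ n (extendByZero φ) (Subtype.val '' (W : Set V)) := by
  rintro _ ⟨y, hy, rfl⟩
  have h1 : ContMDiffAt 𝓘(ℝ, E3) 𝓘(ℝ, ℝ) n φ y := hφ.contMDiffAt (W.isOpen.mem_nhds hy)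
  exact ((OpensChart.contMDiffAt_iff y φ (extendByZero φ)
    fun y ↦ (extendByZero_val φ y).symm).1 h1).contDiffWithinAt

/-- **The manifold differential of `φ` on `V` is the Fréchet derivative of its extension by
zero** (both are the junk value `0` where `φ` is not differentiable). [folklore] -/
theorem mfderiv_eq_fderiv_extendByZero (φ : V → ℝ) (y : V) :
    mfderiv 𝓘(ℝ, E3) 𝓘(ℝ, ℝ) φ y = fderiv ℝ (extendByZero φ) (y : E3) := by
  by_cases hd : DifferentiableAt ℝ (extendByZero φ) (y : E3)
  · exact OpensChart.mfderiv_eq y φ _ (fun y ↦ (extendByZero_val φ y).symm) hd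
  · have hmd : ¬ MDifferentiableAt 𝓘(ℝ, E3) 𝓘(ℝ, ℝ) φ y := fun h ↦
      hd ((OpensChart.mdifferentiableAt_iff y φ _ fun y ↦ (extendByZero_val φ y).symm).1 h)
    rw [mfderiv_zero_of_not_mdifferentiableAt hmd, fderiv_zero_of_not_differentiableAt hd]
    rfl

variable (R : ℝ) (hR : 0 < R) (hV : ∀ x : E3, R < ‖x‖ → x ∈ V)

/-- Points of the far regions of an inclusion end: `q ∈ far R'` iff `R' < ‖q‖` (`R ≤ R'`).
[folklore] -/
theorem mem_far_inclusionAFEnd_iff {R' : ℝ} (hRR' : R ≤ R') {q : V} :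
    q ∈ (inclusionAFEnd V R hR hV).far R' ↔ R' < ‖(q : E3)‖ := by
  rw [AFEnd.mem_far_iff]
  constructor
  · rintro ⟨z, hz, rfl⟩
    exact hz
  · intro hq
    exact ⟨⟨q, hRR'.trans_lt hq⟩, hq, Subtype.ext rfl⟩

/-- The extended inverse chart of an inclusion end is the inclusion on the exterior region.
[folklore] -/
theorem dataChartExt_inclusionAFEnd {z : E3} (hz : R < ‖z‖) :
    (inclusionAFEnd V R hR hV).dataChartExt z = ⟨z, hV z hz⟩ := by
  rw [(inclusionAFEnd V R hR hV).dataChartExt_of_lt (show (inclusionAFEnd V R hR hV).R < ‖z‖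
    from hz)]
  rfl

/-- **Behaviour at infinity through the extension by zero**: for an inclusion end of `V`,
`φ → c` at infinity in the end iff `φ̃ → c` along the cobounded filter of `ℝ³`. [folklore] -/
theorem tendstoAtEnd_inclusionAFEnd_iff (φ : V → ℝ) (c : ℝ) :
    TendstoAtEnd (inclusionAFEnd V R hR hV) φ c ↔
      Tendsto (extendByZero φ) (cobounded E3) (𝓝 c) := by
  refine Filter.tendsto_congr' ?_
  filter_upwards [eventually_cobounded_le_norm (E := E3) (R + 1)] with x hx
  have hx' : R < ‖x‖ := by linarith
  rw [endValue_of_lt _ φ (show (inclusionAFEnd V R hR hV).R < ‖x‖ from hx'),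
    extendByZero_of_mem φ (hV x hx')]
  congr 1

end OpensTransfer

/-! ### Part IV. The conformally flat metric `ψ⁴ δ`: slope and volume density -/

section Conformal

open Manifold TopologicalSpace PseudoRiemannianMetric Schwarzschild
open scoped InnerProductSpace

variable {M : ℝ} {V : Opens E3} (hM : 0 ≤ M) (hV0 : (0 : E3) ∉ (V : Set E3))

/-- **The slope of a function for the conformal metric `ψ⁴ δ`**: `|∇φ|_{ψ⁴δ} = ψ⁻² ‖∇φ̃‖`
(`h⁻¹ = ψ⁻⁴ δ`). Bray 2001, §1 (the Schwarzschild metric (1)); O'Neill 1983, Ch. 3, p. 60.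
[folklore] -/
theorem gradNorm_conformalData (φ : V → ℝ) (y : V) :
    gradNorm (conformalData V hM hV0).h φ y =
      (conformalFactor M (y : E3) ^ 2)⁻¹ * ‖fderiv ℝ (extendByZero φ) (y : E3)‖ := by
  set ψ : ℝ := conformalFactor M (y : E3) with hψ
  have hψpos : 0 < ψ := conformalFactor_pos hM _
  set g := ofRiemannian (conformalData V hM hV0).h with hg
  -- the differential and its metric dual
  set L : E3 →L[ℝ] ℝ := fderiv ℝ (extendByZero φ) (y : E3) with hL
  have hmf : mfderiv 𝓘(ℝ, E3) 𝓘(ℝ, ℝ) φ y = L := mfderiv_eq_fderiv_extendByZero φ y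
  set v : E3 := g.sharp y L.toLinearMap with hv
  have key : ∀ w : E3, ψ ^ 4 * ⟪v, w⟫_ℝ = L w := fun w ↦ g.val_sharp_apply y L.toLinearMap w
  have hLv : L = (ψ ^ 4) • (innerSL ℝ v : E3 →L[ℝ] ℝ) := by
    ext w
    rw [FunLike.coe_smul, Pi.smul_apply, innerSL_apply_apply, smul_eq_mul, key]
  have hnormL : ‖L‖ = ψ ^ 4 * ‖v‖ := by
    rw [hLv, norm_smul, innerSL_apply_norm, Real.norm_of_nonneg (by positivity)]
  have hdual : g.innerDual y L.toLinearMap L.toLinearMap = ψ ^ 4 * ‖v‖ ^ 2 := by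
    rw [innerDual, ← hv]
    change L v = _
    rw [← key v, real_inner_self_eq_norm_sq]
  unfold gradNorm
  rw [hmf, hdual]
  have : ψ ^ 4 * ‖v‖ ^ 2 = ((ψ ^ 2)⁻¹ * ‖L‖) ^ 2 := by
    rw [hnormL]
    field_simp
  rw [this, Real.sqrt_sq (by positivity)]

/-- The chart components of `ψ⁴ δ` on an inclusion end are `ψ⁴ δ_ij` in the standard basis.
[folklore] -/
theorem hCoeff_conformalData_single (R : ℝ) (hR : 0 < R) (hV : ∀ x : E3, R < ‖x‖ → x ∈ V)
    {z : E3} (hz : R < ‖z‖) (i j : Fin 3) :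
    AFEnd.hCoeff (inclusionAFEnd V R hR hV) (conformalData V hM hV0) z
        (EuclideanSpace.single i 1) (EuclideanSpace.single j 1) =
      conformalFactor M z ^ 4 * (if i = j then 1 else 0) := by
  set e := inclusionAFEnd V R hR hV with he
  have hz' : e.R < ‖z‖ := hz
  -- the differential of the inverse chart `Φ` of an inclusion end is the identity: both
  -- `ι_V ∘ Φ` and `ι_V` read as the identity in the preferred charts (`OpensChart.mfderiv_eq`)
  have hd : ∀ v : E3, mfderiv (𝓡 3) (𝓡 3) e.dataChart ⟨z, hz'⟩ v = v := by
    intro v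
    have hdiff : MDifferentiableAt (𝓡 3) (𝓡 3) e.dataChart ⟨z, hz'⟩ :=
      (e.contMDiff_dataChart _).mdifferentiableAt (by simp)
    have hval : MDifferentiableAt 𝓘(ℝ, E3) 𝓘(ℝ, E3) (Subtype.val : V → E3) (e.dataChart ⟨z, hz'⟩) :=
      (OpensChart.mdifferentiableAt_iff _ Subtype.val id fun _ ↦ rfl).2 differentiableAt_id
    have h2 : mfderiv 𝓘(ℝ, E3) 𝓘(ℝ, E3) (Subtype.val : V → E3) (e.dataChart ⟨z, hz'⟩) =
        ContinuousLinearMap.id ℝ E3 := by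
      rw [OpensChart.mfderiv_eq _ Subtype.val id (fun _ ↦ rfl) differentiableAt_id, fderiv_id]
    have h3 : mfderiv 𝓘(ℝ, E3) 𝓘(ℝ, E3) (Subtype.val ∘ e.dataChart) ⟨z, hz'⟩ =
        ContinuousLinearMap.id ℝ E3 := by
      rw [OpensChart.mfderiv_eq _ (Subtype.val ∘ e.dataChart) id (fun _ ↦ rfl) differentiableAt_id,
        fderiv_id]
    have h4 : mfderiv 𝓘(ℝ, E3) 𝓘(ℝ, E3) (Subtype.val ∘ e.dataChart) ⟨z, hz'⟩ =
        (mfderiv 𝓘(ℝ, E3) 𝓘(ℝ, E3) (Subtype.val : V → E3) (e.dataChart ⟨z, hz'⟩)).comp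
          (mfderiv 𝓘(ℝ, E3) 𝓘(ℝ, E3) e.dataChart ⟨z, hz'⟩) :=
      mfderiv_comp _ hval hdiff
    have h5 := DFunLike.congr_fun h4 v
    rw [h3, h2] at h5
    exact h5.symm
  rw [AFEnd.hCoeff_of_lt (e := e) (conformalData V hM hV0) hz']
  -- generalise over the point and the two vectors (the tangent spaces are `E3` up to unfolding)
  have key : ∀ (p : V) (_ : p = ⟨z, hV z hz⟩) (v' : E3) (_ : v' = EuclideanSpace.single i 1)
      (w' : E3) (_ : w' = EuclideanSpace.single j 1),
      (conformalData V hM hV0).h.inner p v' w' =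
        conformalFactor M z ^ 4 * (if i = j then 1 else 0) := by
    rintro p rfl v' rfl w' rfl
    change conformalInner M V ⟨z, hV z hz⟩ _ _ = _
    rw [conformalInner_apply, orthonormal_iff_ite.1 EuclideanSpace.orthonormal_single i j]
  exact (pullbackBilin_apply (I := 𝓡 3) (I' := 𝓡 3) _ _ _ _ _).trans (key _ rfl _ (hd _) _ (hd _))

/-- **The Riemannian density of `ψ⁴ δ` is `ψ⁶`**: `√(det (ψ⁴ δ_ij)) = ψ⁶`. [folklore] -/
theorem sqrt_det_hCoeff_conformalData (R : ℝ) (hR : 0 < R) (hV : ∀ x : E3, R < ‖x‖ → x ∈ V)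
    {z : E3} (hz : R < ‖z‖) :
    Real.sqrt (Matrix.of fun i j ↦ AFEnd.hCoeff (inclusionAFEnd V R hR hV)
        (conformalData V hM hV0) z (EuclideanSpace.single i 1) (EuclideanSpace.single j 1)).det =
      conformalFactor M z ^ 6 := by
  have hmat : (Matrix.of fun i j ↦ AFEnd.hCoeff (inclusionAFEnd V R hR hV)
      (conformalData V hM hV0) z (EuclideanSpace.single i 1) (EuclideanSpace.single j 1)) =
      conformalFactor M z ^ 4 • (1 : Matrix (Fin 3) (Fin 3) ℝ) := by
    ext i j
    rw [Matrix.of_apply, hCoeff_conformalData_single hM hV0 R hR hV hz, Matrix.smul_apply,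
      Matrix.one_apply, smul_eq_mul]
  rw [hmat, Matrix.det_smul, Matrix.det_one, mul_one, Fintype.card_fin]
  have h0 : 0 ≤ conformalFactor M z := (conformalFactor_pos hM z).le
  rw [show (conformalFactor M z ^ 4) ^ 3 = (conformalFactor M z ^ 6) ^ 2 by ring,
    Real.sqrt_sq (by positivity)]

/-- **Integration over the shell `{R' < r}` for `ψ⁴ δ`**: for `g : V → [0, ∞]`,
`∫_{R' < r} g dvol_{ψ⁴δ} = ∫_{R' < ‖z‖} g(z) ψ(z)⁶ dz` (`R ≤ R'`). [folklore] -/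
theorem setLIntegral_far_conformalData (R : ℝ) (hR : 0 < R) (hV : ∀ x : E3, R < ‖x‖ → x ∈ V)
    (g : V → ℝ≥0∞) {R' : ℝ} (hRR' : R ≤ R') :
    ∫⁻ p in (inclusionAFEnd V R hR hV).far R', g p ∂riemannianMeasure (conformalData V hM hV0).h =
      ∫⁻ z in {z : E3 | R' < ‖z‖}, g ((inclusionAFEnd V R hR hV).dataChartExt z) *
        ENNReal.ofReal (conformalFactor M z ^ 6) := by
  haveI : LocallyCompactSpace V := V.2.locallyCompactSpace
  rw [(inclusionAFEnd V R hR hV).setLIntegral_far (conformalData V hM hV0) g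
    (show (inclusionAFEnd V R hR hV).R ≤ R' from hRR')]
  refine setLIntegral_congr_fun (isOpen_lt continuous_const continuous_norm).measurableSet
    fun z hz ↦ ?_
  rw [sqrt_det_hCoeff_conformalData hM hV0 R hR hV (hRR'.trans_lt hz)]

/-- **Coordinate spheres are null for `dvol_{ψ⁴δ}`** (`R < ρ`): the Riemannian measure has a
density against Lebesgue measure in the chart, and Euclidean spheres are Lebesgue-null.
[folklore] -/
theorem riemannianMeasure_conformalData_sphere (R : ℝ) (hR : 0 < R)
    (hV : ∀ x : E3, R < ‖x‖ → x ∈ V) {ρ : ℝ} (hρ : R < ρ) :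
    riemannianMeasure (conformalData V hM hV0).h
      {q : V | ‖(q : E3)‖ = ρ} = 0 := by
  haveI : LocallyCompactSpace V := V.2.locallyCompactSpace
  have hsub : sphere (0 : E3) ρ ⊆ {z : E3 | (inclusionAFEnd V R hR hV).R < ‖z‖} := by
    intro z hz
    rw [mem_sphere_zero_iff_norm] at hz
    show R < ‖z‖
    rw [hz]; exact hρ
  have himage : (inclusionAFEnd V R hR hV).dataChartExt '' sphere (0 : E3) ρ =
      {q : V | ‖(q : E3)‖ = ρ} := by
    ext q
    constructor
    · rintro ⟨z, hz, rfl⟩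
      rw [mem_sphere_zero_iff_norm] at hz
      show ‖((inclusionAFEnd V R hR hV).dataChartExt z : E3)‖ = ρ
      rw [dataChartExt_inclusionAFEnd R hR hV (show R < ‖z‖ by rw [hz]; exact hρ)]
      exact hz
    · intro hq
      refine ⟨q, mem_sphere_zero_iff_norm.2 hq, ?_⟩
      rw [dataChartExt_inclusionAFEnd R hR hV (show R < ‖(q : E3)‖ by
        rw [show ‖(q : E3)‖ = ρ from hq]; exact hρ)]
  rw [← himage, (inclusionAFEnd V R hR hV).riemannianMeasure_image_dataChartExt
    (conformalData V hM hV0) isClosed_sphere.measurableSet hsub,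
    setLIntegral_measure_zero _ _ (Measure.addHaar_sphere volume (0 : E3) ρ)]

end Conformal

/-! ### Part V. The Schwarzschild Green's function `(r - a)/(r + a)` in `ℝ³` -/

section Green

open Bornology

/-- The **Schwarzschild capacity profile** `max(0, (‖z‖ - a)/(‖z‖ + a))` on `ℝ³`: Bray's
minimising Green's function (86) for the Schwarzschild horizon `r = a = m/2`,
`(1 - m/2r)/(1 + m/2r)`, extended by zero inside. Bray 2001, §6, (86)–(87) with (12).
[cite: BrayRPI2001, §6 Def. 17 (86)] -/
def greenProfile (a : ℝ) (z : E3) : ℝ :=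
  max 0 ((‖z‖ - a) / (‖z‖ + a))

/-- Inside the closed ball the profile vanishes. [folklore] -/
theorem greenProfile_eq_zero_of_le {a : ℝ} (ha : 0 < a) {z : E3} (hz : ‖z‖ ≤ a) :
    greenProfile a z = 0 :=
  max_eq_left (div_nonpos_of_nonpos_of_nonneg (by linarith) (by positivity))

/-- Outside the closed ball the profile is the quotient `(‖z‖ - a)/(‖z‖ + a)`. [folklore] -/
theorem greenProfile_eq_of_lt {a : ℝ} (ha : 0 < a) {z : E3} (hz : a < ‖z‖) :
    greenProfile a z = (‖z‖ - a) / (‖z‖ + a) :=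
  max_eq_right (div_nonneg (by linarith) (by positivity))

/-- The profile is continuous (`a > 0`). [folklore] -/
theorem continuous_greenProfile {a : ℝ} (ha : 0 < a) : Continuous (greenProfile a) := by
  unfold greenProfile
  exact continuous_const.max ((continuous_norm.sub continuous_const).div
    (continuous_norm.add continuous_const) fun z ↦ (by positivity : (0 : ℝ) < ‖z‖ + a).ne')

/-- The profile is smooth outside the closed ball. [folklore] -/
theorem contDiffAt_greenProfile {a : ℝ} (ha : 0 < a) {n : WithTop ℕ∞} {z : E3} (hz : a < ‖z‖) :
    ContDiffAt ℝ n (greenProfile a) z := by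
  have hz0 : z ≠ 0 := fun h ↦ by rw [h, norm_zero] at hz; linarith
  have hq : ContDiffAt ℝ n (fun w : E3 ↦ (‖w‖ - a) / (‖w‖ + a)) z :=
    ((contDiffAt_norm ℝ hz0).sub contDiffAt_const).div ((contDiffAt_norm ℝ hz0).add
      contDiffAt_const) (by positivity : (0 : ℝ) < ‖z‖ + a).ne'
  refine hq.congr_of_eventuallyEq ?_
  filter_upwards [(isOpen_lt continuous_const continuous_norm).mem_nhds hz] with w hw
  exact greenProfile_eq_of_lt ha hw

/-- The profile tends to `1` at infinity. [folklore] -/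
theorem tendsto_greenProfile {a : ℝ} (ha : 0 < a) :
    Tendsto (greenProfile a) (cobounded E3) (𝓝 1) := by
  have hn : Tendsto (fun z : E3 ↦ ‖z‖ + a) (cobounded E3) atTop :=
    tendsto_atTop_add_const_right _ _ tendsto_norm_cobounded_atTop
  have h2 : Tendsto (fun z : E3 ↦ 2 * a / (‖z‖ + a)) (cobounded E3) (𝓝 0) :=
    tendsto_const_nhds.div_atTop hn
  have h3' : Tendsto (fun z : E3 ↦ (1 : ℝ) - 2 * a / (‖z‖ + a)) (cobounded E3) (𝓝 (1 - 0)) :=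
    tendsto_const_nhds.sub h2
  have h3 : Tendsto (fun z : E3 ↦ max 0 (1 - 2 * a / (‖z‖ + a))) (cobounded E3)
      (𝓝 (max 0 (1 - 0))) := tendsto_const_nhds.max h3'
  rw [sub_zero, max_eq_right zero_le_one] at h3
  refine h3.congr' ?_
  filter_upwards [eventually_cobounded_le_norm (E := E3) 0] with z hz
  unfold greenProfile
  congr 1
  have : ‖z‖ + a ≠ 0 := (by positivity : (0 : ℝ) < ‖z‖ + a).ne'
  field_simp
  ring

/-- **The gradient bound for the profile**: `‖∇ greenProfile(z)‖ ≤ 2a/(‖z‖ + a)²` outside the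
closed ball (chain rule, `‖∇ ‖·‖‖ ≤ 1`). [folklore] -/
theorem norm_fderiv_greenProfile_le {a : ℝ} (ha : 0 < a) {z : E3} (hz : a < ‖z‖) {Φ : E3 → ℝ}
    (hΦ : Φ =ᶠ[𝓝 z] greenProfile a) :
    ‖fderiv ℝ Φ z‖ ≤ 2 * a / (‖z‖ + a) ^ 2 := by
  have hz0 : z ≠ 0 := fun h ↦ by rw [h, norm_zero] at hz; linarith
  have hza : 0 < ‖z‖ + a := by positivity
  have heq : Φ =ᶠ[𝓝 z] fun w : E3 ↦ (‖w‖ - a) / (‖w‖ + a) := by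
    apply hΦ.trans
    filter_upwards [(isOpen_lt continuous_const continuous_norm).mem_nhds hz] with w hw
    exact greenProfile_eq_of_lt ha hw
  rw [heq.fderiv_eq]
  have hk : HasDerivAt (fun r : ℝ ↦ (r - a) / (r + a)) (2 * a / (‖z‖ + a) ^ 2) ‖z‖ := by
    have h1 : HasDerivAt (fun r : ℝ ↦ r - a) 1 ‖z‖ := (hasDerivAt_id _).sub_const a
    have h2 : HasDerivAt (fun r : ℝ ↦ r + a) 1 ‖z‖ := (hasDerivAt_id _).add_const a
    have h3 : HasDerivAt (fun r : ℝ ↦ (r - a) / (r + a))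
        ((1 * (‖z‖ + a) - (‖z‖ - a) * 1) / (‖z‖ + a) ^ 2) ‖z‖ := h1.div h2 hza.ne'
    exact h3.congr_deriv (by ring)
  have hn : HasFDerivAt (fun w : E3 ↦ ‖w‖) (fderiv ℝ (fun w : E3 ↦ ‖w‖) z) z :=
    (differentiableAt_id.norm ℝ hz0).hasFDerivAt
  have hcomp := hk.comp_hasFDerivAt z hn
  rw [show (fun w : E3 ↦ (‖w‖ - a) / (‖w‖ + a)) =
      (fun r : ℝ ↦ (r - a) / (r + a)) ∘ (fun w : E3 ↦ ‖w‖) from rfl, hcomp.fderiv, norm_smul,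
    Real.norm_of_nonneg (by positivity)]
  calc 2 * a / (‖z‖ + a) ^ 2 * ‖fderiv ℝ (fun w : E3 ↦ ‖w‖) z‖
      ≤ 2 * a / (‖z‖ + a) ^ 2 * 1 := by
        gcongr
        exact_mod_cast norm_fderiv_le_of_lipschitz ℝ (lipschitzWith_one_norm (E := E3))
    _ = 2 * a / (‖z‖ + a) ^ 2 := mul_one _

end Green

end SchwarzschildCapacity

/-! ### Part VI. The capacity of the Schwarzschild horizon is `2m` -/

namespace Schwarzschild

open Bornology Manifold TopologicalSpace SchwarzschildCapacity

/-- The punctured slice, an open subset of `ℝ³`, is locally compact (needed to form capacities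
on it). [folklore] -/
instance : LocallyCompactSpace puncturedSlice := puncturedSlice.2.locallyCompactSpace

/-- The **open outside `{m/2 < ‖y‖}` of the Schwarzschild horizon** (the minimal throat
`‖y‖ = m/2`) inside the two-ended punctured slice `E3 ∖ {0}`: the outside region `U` of the
horizon `Σ ∈ 𝒮` in the sense of `MassCapacity.lean`. Bray 2001, §1 with (12); §2 Def. 3.
[cite: BrayRPI2001, §1 (12)] -/
def throatOutside (M : ℝ) : Opens puncturedSlice :=
  ⟨{y | M / 2 < ‖(y : E3)‖}, isOpen_lt continuous_const (continuous_norm.comp continuous_subtype_val)⟩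

/-- Membership in `throatOutside` (by `Iff.rfl`). [folklore] -/
theorem mem_throatOutside {M : ℝ} {y : puncturedSlice} :
    y ∈ throatOutside M ↔ M / 2 < ‖(y : E3)‖ := Iff.rfl

/-- The **asymptotically flat end of the punctured slice** with inner coordinate radius `R > 0`
(tautological chart, `inclusionAFEnd`). Bartnik 1986, §1; Bray 2001, §1. [cite: BrayRPI2001, §1] -/
def sliceEnd (R : ℝ) (hR : 0 < R) : AFEnd puncturedSlice :=
  inclusionAFEnd puncturedSlice R hR fun _ hx ↦ mem_puncturedSlice.2 (hR.trans hx)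

/-- **Bray's Green's function of the Schwarzschild horizon** on the punctured slice:
`φ(y) = (1 - m/2‖y‖)/(1 + m/2‖y‖) = (‖y‖ - m/2)/(‖y‖ + m/2)` outside the horizon, `0` on and
inside it — the minimiser (86) of Def. 17 for the Schwarzschild metric (12), with
`φ = 1 - 2m/(2‖y‖) + O(‖y‖⁻²)`, i.e. `ℰ = 2m` in (87). [cite: BrayRPI2001, §6 (86)–(87) with (12)] -/
def greenFn (M : ℝ) (y : puncturedSlice) : ℝ :=
  greenProfile (M / 2) (y : E3)

/-- The extension by zero of `greenFn` to `ℝ³` is the profile off the origin. [folklore] -/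
theorem extendByZero_greenFn_eventuallyEq {M : ℝ} {z : E3} (hz : z ≠ 0) :
    extendByZero (greenFn M) =ᶠ[𝓝 z] greenProfile (M / 2) := by
  filter_upwards [isOpen_compl_singleton.mem_nhds hz] with w hw
  exact extendByZero_of_mem (greenFn M) (mem_puncturedSlice.2 (norm_pos_iff.2 hw))

/-- **`greenFn` is a test function of Def. 17** for the horizon `‖y‖ = m/2` with outside
`throatOutside m` in the end `sliceEnd R` (`m > 0`): continuous, smooth outside, zero on and
inside the horizon, `→ 1` at infinity. [cite: BrayRPI2001, §6 Def. 17 (86)] -/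
theorem isCapacityTestFn_greenFn {M : ℝ} (hM : 0 < M) {R : ℝ} (hR : 0 < R) :
    IsCapacityTestFn (sliceEnd R hR) (throatOutside M) (greenFn M) := by
  have ha : 0 < M / 2 := by positivity
  refine ⟨(continuous_greenProfile ha).comp continuous_subtype_val, ?_, ?_, ?_⟩
  · intro y hy
    exact ((OpensChart.contMDiffAt_iff y (greenFn M) (greenProfile (M / 2)) fun _ ↦ rfl).2
      (contDiffAt_greenProfile ha hy)).contMDiffWithinAt
  · intro y hy
    exact greenProfile_eq_zero_of_le ha (not_lt.1 hy)
  · rw [sliceEnd, tendstoAtEnd_inclusionAFEnd_iff]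
    refine (tendsto_greenProfile ha).congr' ?_
    filter_upwards [eventually_cobounded_le_norm (E := E3) 1] with z hz
    have hz0 : z ≠ 0 := fun h ↦ by rw [h, norm_zero] at hz; linarith
    exact ((extendByZero_greenFn_eventuallyEq (M := M) hz0).eq_of_nhds).symm

/-- **The Dirichlet energy of Bray's Green's function is at most `4πm`** (it equals `4πm`):
`∫ |∇φ|²_{ψ⁴δ} dV_{ψ⁴δ} = ∫_{‖z‖ > m/2} ψ² ‖∇φ̃‖² dz ≤ ∫ 4a²/(r²(r+a)²) dz = 8πa`, `a = m/2`.
Bray 2001, §6, (85)–(87) for the metric (12). [cite: BrayRPI2001, §6 Def. 17 (85)–(87)] -/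
theorem dirichletEnergy_greenFn_le {M : ℝ} (hM : 0 < M) :
    dirichletEnergy (timeSymmetricData M hM.le).h (greenFn M) ≤ ENNReal.ofReal (4 * π * M) := by
  set a := M / 2 with ha_def
  have ha : 0 < a := by positivity
  have ha2 : 0 < a / 2 := by positivity
  have hψ : ∀ z : E3, conformalFactor M z = 1 + a / ‖z‖ := fun z ↦ by
    rw [conformalFactor_apply, ha_def]; ring
  have hVa : ∀ x : E3, a / 2 < ‖x‖ → x ∈ (puncturedSlice : Opens E3) := fun x hx ↦
    mem_puncturedSlice.2 (ha2.trans hx)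
  set e₀ : AFEnd puncturedSlice := inclusionAFEnd puncturedSlice (a / 2) ha2 hVa with he₀
  unfold timeSymmetricData
  set h := (conformalData puncturedSlice hM.le zero_notMem_puncturedSlice).h with hh
  set g : puncturedSlice → ℝ≥0∞ := fun p ↦ ENNReal.ofReal (gradNorm h (greenFn M) p ^ 2) with hg
  simp only [dirichletEnergy]
  rw [← hg, ← lintegral_add_compl g (e₀.isOpen_far (a / 2)).measurableSet]
  -- inside the ball `‖p‖ ≤ a/2` the integrand vanishes identically
  have hcompl : ∫⁻ p in (e₀.far (a / 2))ᶜ, g p ∂riemannianMeasure h = 0 := by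
    rw [setLIntegral_congr_fun (e₀.isOpen_far (a / 2)).measurableSet.compl (g := fun _ ↦ 0)
      fun p hp ↦ ?_, lintegral_zero]
    have hp' : ‖(p : E3)‖ ≤ a / 2 := not_lt.1 fun h' ↦
      hp ((mem_far_inclusionAFEnd_iff (a / 2) ha2 hVa le_rfl).2 h')
    show ENNReal.ofReal (gradNorm h (greenFn M) p ^ 2) = 0
    rw [gradNorm_eq_zero_of_eventuallyEq_const h (c := 0) ?_]
    · simp
    filter_upwards [(isOpen_lt (continuous_norm.comp continuous_subtype_val)
      continuous_const).mem_nhds (show ‖(p : E3)‖ < a by linarith)] with q hq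
    exact greenProfile_eq_zero_of_le ha (le_of_lt hq)
  rw [hcompl, add_zero, hh, setLIntegral_far_conformalData hM.le zero_notMem_puncturedSlice
    (a / 2) ha2 hVa g le_rfl]
  -- pointwise bound in the chart
  have hmeas : MeasurableSet {z : E3 | a / 2 < ‖z‖} :=
    (isOpen_lt continuous_const continuous_norm).measurableSet
  have hmeas' : MeasurableSet {z : E3 | a < ‖z‖} :=
    (isOpen_lt continuous_const continuous_norm).measurableSet
  have hpt : ∀ z ∈ {z : E3 | a / 2 < ‖z‖},
      g (e₀.dataChartExt z) * ENNReal.ofReal (conformalFactor M z ^ 6) ≤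
        {z : E3 | a < ‖z‖}.indicator
            (fun z ↦ ENNReal.ofReal (4 * a ^ 2 / (‖z‖ ^ 2 * (‖z‖ + a) ^ 2))) z +
          (sphere (0 : E3) a).indicator (fun _ ↦ ∞) z := by
    intro z hz
    have hz' : a / 2 < ‖z‖ := hz
    have hz0 : z ≠ 0 := fun h ↦ by
      rw [h, norm_zero] at hz'; exact (lt_irrefl _ (ha2.trans hz'))
    rw [he₀, dataChartExt_inclusionAFEnd (a / 2) ha2 hVa hz', hg]
    dsimp only
    rw [gradNorm_conformalData hM.le zero_notMem_puncturedSlice (greenFn M) ⟨z, hVa z hz⟩]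
    rcases lt_trichotomy ‖z‖ a with hlt | heq | hgt
    · -- inside the horizon: the extension by zero vanishes near `z`
      have hfd : fderiv ℝ (extendByZero (greenFn M)) z = 0 := by
        have hev : extendByZero (greenFn M) =ᶠ[𝓝 z] fun _ ↦ (0 : ℝ) := by
          apply (extendByZero_greenFn_eventuallyEq (M := M) hz0).trans
          filter_upwards [(isOpen_lt continuous_norm continuous_const).mem_nhds hlt] with w hw
          exact greenProfile_eq_zero_of_le ha hw.le
        rw [hev.fderiv_eq, fderiv_const_apply]
      simp [hfd]
    · -- on the horizon (a null set): the trivial bound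
      have hzs : z ∈ sphere (0 : E3) a := mem_sphere_zero_iff_norm.2 heq
      rw [indicator_of_mem hzs]
      exact le_add_left le_top
    · -- outside the horizon: `ψ² ‖∇φ‖² ≤ 4a²/(r²(r+a)²)`
      have hzo : z ∈ {z : E3 | a < ‖z‖} := hgt
      have hzs : z ∉ sphere (0 : E3) a := fun h' ↦ (ne_of_gt hgt) (mem_sphere_zero_iff_norm.1 h')
      rw [indicator_of_mem hzo, indicator_of_notMem hzs, add_zero,
        ← ENNReal.ofReal_mul (sq_nonneg _)]
      apply ENNReal.ofReal_le_ofReal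
      have hbd : ‖fderiv ℝ (extendByZero (greenFn M)) z‖ ≤ 2 * a / (‖z‖ + a) ^ 2 :=
        norm_fderiv_greenProfile_le ha hgt (extendByZero_greenFn_eventuallyEq (M := M) hz0)
      have hr : 0 < ‖z‖ := ha.trans hgt
      rw [hψ z]
      have hψz : 0 < 1 + a / ‖z‖ := by positivity
      calc (((1 + a / ‖z‖) ^ 2)⁻¹ * ‖fderiv ℝ (extendByZero (greenFn M)) z‖) ^ 2 *
            (1 + a / ‖z‖) ^ 6
          = (1 + a / ‖z‖) ^ 2 * ‖fderiv ℝ (extendByZero (greenFn M)) z‖ ^ 2 := by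
            field_simp
        _ ≤ (1 + a / ‖z‖) ^ 2 * (2 * a / (‖z‖ + a) ^ 2) ^ 2 := by gcongr
        _ = 4 * a ^ 2 / (‖z‖ ^ 2 * (‖z‖ + a) ^ 2) := by
            field_simp
            ring
  have hsph : Measurable ((sphere (0 : E3) a).indicator fun _ ↦ (∞ : ℝ≥0∞)) :=
    measurable_const.indicator isClosed_sphere.measurableSet
  calc ∫⁻ z in {z : E3 | a / 2 < ‖z‖}, g (e₀.dataChartExt z) * ENNReal.ofReal (conformalFactor M z ^ 6)
      ≤ ∫⁻ z in {z : E3 | a / 2 < ‖z‖}, ({z : E3 | a < ‖z‖}.indicator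
            (fun z ↦ ENNReal.ofReal (4 * a ^ 2 / (‖z‖ ^ 2 * (‖z‖ + a) ^ 2))) z +
          (sphere (0 : E3) a).indicator (fun _ ↦ ∞) z) := setLIntegral_mono' hmeas hpt
    _ ≤ ∫⁻ z, ({z : E3 | a < ‖z‖}.indicator
            (fun z ↦ ENNReal.ofReal (4 * a ^ 2 / (‖z‖ ^ 2 * (‖z‖ + a) ^ 2))) z +
          (sphere (0 : E3) a).indicator (fun _ ↦ ∞) z) := setLIntegral_le_lintegral _ _
    _ = ∫⁻ z in {z : E3 | a < ‖z‖}, ENNReal.ofReal (4 * a ^ 2 / (‖z‖ ^ 2 * (‖z‖ + a) ^ 2)) := by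
        rw [lintegral_add_right _ hsph, lintegral_indicator hmeas',
          lintegral_indicator isClosed_sphere.measurableSet, setLIntegral_const,
          Measure.addHaar_sphere volume (0 : E3) a]
        simp
    _ ≤ ENNReal.ofReal (8 * π * a) := lintegral_shell_profile_le ha
    _ = ENNReal.ofReal (4 * π * M) := by rw [ha_def]; congr 1; ring

/-- **The Dirichlet energy of every test function is at least `4πm`**: for `φ` continuous on the
punctured slice, smooth outside the horizon `‖y‖ = m/2`, zero on and inside it and `→ 1` at
infinity, `∫ |∇φ|²_{ψ⁴δ} dV_{ψ⁴δ} ≥ ∫_{‖z‖ > m/2} ψ² ‖∇φ̃‖² dz ≥ 4πm` (Part II with `a = m/2`).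
Bray 2001, §6, Def. 17 and Thm. 9 (case of equality) for the metric (12).
[cite: BrayRPI2001, §6 Def. 17 and Thm. 9] -/
theorem le_dirichletEnergy_of_isCapacityTestFn {M : ℝ} (hM : 0 < M) {R : ℝ} (hR : 0 < R)
    {φ : puncturedSlice → ℝ} (hφ : IsCapacityTestFn (sliceEnd R hR) (throatOutside M) φ) :
    ENNReal.ofReal (4 * π * M) ≤ dirichletEnergy (timeSymmetricData M hM.le).h φ := by
  obtain ⟨hcont, hdiff, hzero, hlim⟩ := hφ
  set a := M / 2 with ha_def
  have ha : 0 < a := by positivity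
  have hψ : ∀ z : E3, conformalFactor M z = 1 + a / ‖z‖ := fun z ↦ by
    rw [conformalFactor_apply, ha_def]; ring
  have hmemV : ∀ z : E3, a ≤ ‖z‖ → z ∈ (puncturedSlice : Opens E3) := fun z hz ↦
    mem_puncturedSlice.2 (ha.trans_le hz)
  have hVa : ∀ x : E3, a < ‖x‖ → x ∈ (puncturedSlice : Opens E3) := fun x hx ↦ hmemV x hx.le
  -- the hypotheses of Part II for the extension by zero
  have h1 : ∀ x : E3, ‖x‖ = a → ContinuousAt (extendByZero φ) x := fun x hx ↦
    continuousAt_extendByZero hcont ⟨x, hmemV x hx.ge⟩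
  have h2 : ContDiffOn ℝ 1 (extendByZero φ) {x : E3 | a < ‖x‖} := by
    have himg : Subtype.val '' ((throatOutside M : Opens puncturedSlice) : Set puncturedSlice) =
        {x : E3 | a < ‖x‖} := by
      ext x
      constructor
      · rintro ⟨y, hy, rfl⟩
        exact hy
      · intro hx
        exact ⟨⟨x, hVa x hx⟩, hx, rfl⟩
    rw [← himg]
    exact (contDiffOn_extendByZero hdiff).of_le (by exact_mod_cast le_top)
  have h3 : ∀ x : E3, ‖x‖ = a → extendByZero φ x = 0 := fun x hx ↦ by
    rw [extendByZero_of_mem φ (hmemV x hx.ge)]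
    refine hzero _ fun h ↦ (lt_irrefl a) ?_
    rw [SetLike.mem_coe, mem_throatOutside] at h
    have h' : M / 2 < ‖x‖ := h
    rwa [hx] at h'
  have h4 : Tendsto (extendByZero φ) (cobounded E3) (𝓝 1) := by
    rw [sliceEnd, tendstoAtEnd_inclusionAFEnd_iff] at hlim
    exact hlim
  have hII := le_lintegral_shell_conformalGradSq ha h1 h2 h3 h4
  have h8 : 8 * π * a = 4 * π * M := by rw [ha_def]; ring
  rw [h8] at hII
  refine hII.trans ?_
  -- the chart formula for the end of inner radius `a`
  unfold timeSymmetricData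
  set h := (conformalData puncturedSlice hM.le zero_notMem_puncturedSlice).h with hh
  simp only [dirichletEnergy]
  set e₀ : AFEnd puncturedSlice := inclusionAFEnd puncturedSlice a ha hVa with he₀
  have hfar := setLIntegral_far_conformalData hM.le zero_notMem_puncturedSlice a ha hVa
    (fun p ↦ ENNReal.ofReal (gradNorm h φ p ^ 2)) le_rfl
  calc ∫⁻ x in {x : E3 | a < ‖x‖},
        ENNReal.ofReal ((1 + a / ‖x‖) ^ 2 * ‖fderiv ℝ (extendByZero φ) x‖ ^ 2)
      = ∫⁻ z in {z : E3 | a < ‖z‖}, ENNReal.ofReal (gradNorm h φ (e₀.dataChartExt z) ^ 2) *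
          ENNReal.ofReal (conformalFactor M z ^ 6) := by
        refine setLIntegral_congr_fun (isOpen_lt continuous_const continuous_norm).measurableSet
          fun z hz ↦ ?_
        rw [he₀, dataChartExt_inclusionAFEnd a ha hVa hz, hh,
          gradNorm_conformalData hM.le zero_notMem_puncturedSlice φ ⟨z, hVa z hz⟩,
          ← ENNReal.ofReal_mul (sq_nonneg _), hψ z]
        congr 1
        have hz0 : 0 < ‖z‖ := ha.trans hz
        have hψz : 0 < 1 + a / ‖z‖ := by positivity
        field_simp
    _ = ∫⁻ p in e₀.far a, ENNReal.ofReal (gradNorm h φ p ^ 2) ∂riemannianMeasure h := hfar.symm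
    _ ≤ _ := setLIntegral_le_lintegral _ _

/-- **The capacity of the Schwarzschild horizon is `2m`** (Bray, J. Differential Geom. 59
(2001), Thm. 9, case of equality, direction "Schwarzschild ⇒ `m = ½ ℰ(Σ, g)`"; Def. 17 with
(86)–(87) for the Schwarzschild metric (12)): for the time-symmetric Schwarzschild data
`(ℝ³ ∖ {0}, (1 + m/2r)⁴ δ)` of mass `m > 0` (`Schwarzschild.timeSymmetricData`), the capacity
`ℰ(Σ, g)` of Def. 17 — vendored as `horizonCapacity` in `MassCapacity.lean`, the infimum of
`(1/2π) ∫ |∇φ|² dV` over the test functions `IsCapacityTestFn` — of the horizon `Σ = {r = m/2}`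
with outside `{r > m/2}` in the end of the slice equals `2m`, for every inner radius `R > 0` of
the tautological end structure. The infimum is attained by Bray's Green's function
`φ = (1 - m/2r)/(1 + m/2r)` (`greenFn`; upper bound `dirichletEnergy_greenFn_le`), and no
test function does better (`le_dirichletEnergy_of_isCapacityTestFn`: along each ray
`∫_{m/2}^∞ (r + m/2)² (∂_r φ)² dr ≥ m`). This is the model case of the Penrose-equality
statement `Bray2001_capacity_eq_of_penrose_eq` (`ℰ(∂M')/2 = m`) and the non-vacuity check of
the encoding of Def. 17 announced in the docstring of `horizonCapacity`.
[cite: BrayRPI2001, §6 Thm. 9 (case of equality) and Def. 17 (85)–(87), with (12)] -/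
theorem horizonCapacity_timeSymmetricData {M : ℝ} (hM : 0 < M) {R : ℝ} (hR : 0 < R) :
    horizonCapacity (timeSymmetricData M hM.le).h (sliceEnd R hR) (throatOutside M) =
      ENNReal.ofReal (2 * M) := by
  have h2π : ENNReal.ofReal (2 * π)⁻¹ * ENNReal.ofReal (4 * π * M) = ENNReal.ofReal (2 * M) := by
    rw [← ENNReal.ofReal_mul (by positivity)]
    congr 1
    field_simp
    ring
  apply le_antisymm
  · calc horizonCapacity (timeSymmetricData M hM.le).h (sliceEnd R hR) (throatOutside M)
        ≤ ENNReal.ofReal (2 * π)⁻¹ * dirichletEnergy (timeSymmetricData M hM.le).h (greenFn M) :=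
          horizonCapacity_le _ _ _ (isCapacityTestFn_greenFn hM hR)
      _ ≤ ENNReal.ofReal (2 * π)⁻¹ * ENNReal.ofReal (4 * π * M) := by
          gcongr
          exact dirichletEnergy_greenFn_le hM
      _ = ENNReal.ofReal (2 * M) := h2π
  · refine le_iInf₂ fun φ hφ ↦ ?_
    calc ENNReal.ofReal (2 * M) = ENNReal.ofReal (2 * π)⁻¹ * ENNReal.ofReal (4 * π * M) := h2π.symm
      _ ≤ ENNReal.ofReal (2 * π)⁻¹ * dirichletEnergy (timeSymmetricData M hM.le).h φ := by
          gcongr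
          exact le_dirichletEnergy_of_isCapacityTestFn hM hR hφ

/-- **`ℰ(Σ, g)/2 = m` for Schwarzschild** — the conclusion of
`Bray2001_capacity_eq_of_penrose_eq` (`(horizonCapacity …).toReal / 2 = m`) on its rigidity
model. Bray 2001, Thm. 9 (case of equality). [cite: BrayRPI2001, §6 Thm. 9 (case of equality)] -/
theorem horizonCapacity_timeSymmetricData_toReal_div_two {M : ℝ} (hM : 0 < M) {R : ℝ}
    (hR : 0 < R) :
    (horizonCapacity (timeSymmetricData M hM.le).h (sliceEnd R hR) (throatOutside M)).toReal / 2 =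
      M := by
  rw [horizonCapacity_timeSymmetricData hM hR, ENNReal.toReal_ofReal (by positivity)]
  ring

end Schwarzschild

end Literature.Geometry.Lorentzian

end
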